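import Mathlib.Analysis.PSeries
import Mathlib.Data.Nat.Squarefree
import Mathlib.NumberTheory.ArithmeticFunction.Moebius
import Literature.NumberTheory.EllipticCurves.BSDSelmerSmithDensityProofs
import Literature.NumberTheory.EllipticCurves.QuadraticTwistSelmerPInfty
import HarnessLib

/-!
# bsd.S34 (Smith, arXiv:2503.17619, Thm. 1.1): the printed normalisation of the density

A. Smith, *The Birch and Swinnerton-Dyer conjecture implies Goldfeld's conjecture*,
arXiv:2503.17619 (2025), **Theorem 1.1**, is printed as: for every elliptic curve `E/ℚ` and every
`r ≥ 0`,

  `lim_{H → ∞} #{d ∈ ℤ^{≠0} : |d| ≤ H and r_{2^∞}(E^d) = r} / 2H = 1/2 (r = 0), 1/2 (r = 1),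
  0 (r ≥ 2)`,

`d` ranging over **all nonzero integers** and the denominator being `2H = #{0 < |d| ≤ H}`. The
tree's named fact `Literature.NumberTheory.EllipticCurves.smith_selmerCorank_density W`
(`BSDSelmer`, bsd.S34) transcribes it with the natural density `twistDensity` of the same
predicate among **squarefree** `d` ordered by `|d|` (numerator and denominator both restricted to
squarefree `d`). This file PROVES that the two readings are equivalent, curve by curve
(`smith_selmerCorank_density_iff_printed`), so that the vendored statement is exactly as strong
as the printed one. Nothing here proves Theorem 1.1 itself (whose proof, op. cit. §§2–6 with
Smith, arXiv:2207.05674 and arXiv:2207.05143, is far beyond the tree); only theorems are added and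
no statement of `BSDSelmer` is changed.

## The argument

* `selmerCorankTwoInfty_quadraticTwist_mul_sq`: `r_{2^∞}(E^{d e²}) = r_{2^∞}(E^d)` for `e ≠ 0`,
  since `E^{d e²} ≅ E^d` over `ℚ` (`WeierstrassCurve.exists_variableChange_quadraticTwist_mul_sq`)
  and isomorphic curves have isomorphic `2^∞`-Selmer groups
  (`selmerCorank_eq_of_variableChange`, `QuadraticTwistSelmerPInfty`; Silverman, *AEC*, X.§4).
  So the predicate of Thm. 1.1 is a function of the square class of `d`.
* For ANY family `P ⊆ ℤ` invariant under multiplication by nonzero squares,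
  `twistDensity P δ ↔ #{d ≠ 0 : |d| ≤ H, P d}/2H → δ` (`twistDensity_iff_tendsto_of_sq_invariant`).
  Write `A_P(X) = #{d squarefree : |d| ≤ X, P d}`, `A = A_⊤`, `B_P(H) = #{d ≠ 0 : |d| ≤ H, P d}`.
  - Every `d ≠ 0` is uniquely `s m²` with `s` squarefree and `m ≥ 1` (`exists_squarefree_mul_sq`,
    `squarefree_mul_sq_unique`), whence the fibration identity
    `B_P(H) = ∑_{m ≥ 1} A_P(⌊H/m²⌋)` (`nonzeroCount_eq_sum_sqfreeCount`) and in particular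
    `∑_{m ≥ 1} A(⌊H/m²⌋) = 2H` (`sum_sqfreeCount_true`).
  - (⇒) With `D = A_P − δA = o(A)`: `B_P(H) − 2δH = ∑_m D(⌊H/m²⌋)`, and
    `∑_m |D(⌊H/m²⌋)| ≤ ε ∑_m A(⌊H/m²⌋) + C #{m : m² ≤ H} = 2εH + C√H`
    (`tendsto_nonzeroCount_div_of_twistDensity`).
  - (⇐) Möbius inversion over squares, `f(X) = ∑_{k ≤ X} μ(k) F(⌊X/k²⌋)` for
    `F(Y) = ∑_{m ≤ Y} f(⌊Y/m²⌋)` (`moebius_inversion_sq`, from `∑_{k ∣ n} μ(k) = [n = 1]`), gives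
    `D(X) = ∑_{k ≤ X} μ(k) E(⌊X/k²⌋)` with `E(Y) = B_P(Y) − 2δY = o(Y)`, so
    `|D(X)| ≤ 2εX ∑_k k⁻² + C√X ≤ 4εX + C√X`; and `A(X) ≥ X/4` because
    `#{n ≤ X : n not squarefree} ≤ X ∑_{m ≥ 2} m⁻² ≤ (3/4) X`
    (`card_Ioc_filter_not_squarefree_le`, `sqfreeCount_true_ge`), so `A_P/A → δ`
    (`twistDensity_of_tendsto_nonzeroCount_div`). No value of the density of squarefree
    integers (`6/π²`) is needed or claimed.
* `smith_selmerCorank_density_iff_printed` assembles the three clauses (`r = 0`, `r = 1`, and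
  each `r ≥ 2`), and `smith_selmerCorank_density.printed` is the consumer-facing direction.

Densities are taken along `H ∈ ℕ` (as in `twistDensity`); the counting functions only depend on
`⌊H⌋`.

## References

* [arXiv250317619] A. Smith, *The Birch and Swinnerton-Dyer conjecture implies Goldfeld's
  conjecture*, arXiv:2503.17619 (2025): §1, Thm. 1.1 (statement and normalisation `d ∈ ℤ^{≠0}`,
  `|d| ≤ H`, denominator `2H`; twist `E^d : y² = x³ + d²ax + d³b`).
* [SilvermanAEC2009] J. H. Silverman, *The Arithmetic of Elliptic Curves*, 2nd ed., GTM 106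
  (2009): X.2 Prop. 2.4, X.§4, X.5 Cor. 5.4 (twists by `d` and `d e²` are `ℚ`-isomorphic; Selmer
  groups are isomorphism invariants).
* G. H. Hardy, E. M. Wright, *An Introduction to the Theory of Numbers*, 6th ed. (2008), §18.6,
  Thm. 333 (counting squarefree numbers by `n = s m²` and `∑_{d² ∣ n} μ(d)`; only the device is
  used here, not the asymptotic constant).
-/

noncomputable section

open scoped Classical
open Filter Topology Finset
open scoped ArithmeticFunction.Moebius

namespace Literature.NumberTheory.EllipticCurves

/-! ### Squarefree decomposition `d = s · m²` of a nonzero integer -/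

/-- Every nonzero integer is `s · m²` with `s` squarefree and `m ≥ 1` (from Mathlib's
`Nat.sq_mul_squarefree_of_pos` and the sign). [folklore] -/
theorem exists_squarefree_mul_sq {d : ℤ} (hd : d ≠ 0) :
    ∃ s : ℤ, ∃ m : ℕ, 0 < m ∧ Squarefree s ∧ s * (m : ℤ) ^ 2 = d := by
  obtain ⟨a, b, -, hb, hab, ha⟩ := Nat.sq_mul_squarefree_of_pos (Int.natAbs_pos.2 hd)
  have hab' : ((b : ℤ) ^ 2 * a : ℤ) = (d.natAbs : ℤ) := by exact_mod_cast hab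
  rcases Int.natAbs_eq d with h | h
  · refine ⟨a, b, hb, Int.squarefree_natCast.2 ha, ?_⟩
    rw [h, ← hab']
    ring
  · refine ⟨-a, b, hb, ?_, ?_⟩
    · exact Int.squarefree_natAbs.1 (by simpa using ha)
    · rw [h, ← hab']
      ring

/-- Uniqueness of the square part over `ℕ`: if `a · m² = a' · m'²` with `a, a'` squarefree and
`m ≥ 1` then `m = m'` (write `m = g u`, `m' = g u'` with `u, u'` coprime; then `u² ∣ a'`
forces `u = 1`, and symmetrically `u' = 1`). [folklore] -/
theorem sq_part_unique {a a' m m' : ℕ} (ha : Squarefree a) (ha' : Squarefree a') (hm : 0 < m)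
    (h : a * m ^ 2 = a' * m' ^ 2) : m = m' := by
  obtain ⟨u, u', hcop, hu, hu'⟩ := Nat.exists_coprime m m'
  set g := Nat.gcd m m' with hg
  have hg0 : 0 < g := Nat.gcd_pos_of_pos_left _ hm
  have h2 : a * u ^ 2 = a' * u' ^ 2 := by
    have h' : a * u ^ 2 * g ^ 2 = a' * u' ^ 2 * g ^ 2 := by
      calc a * u ^ 2 * g ^ 2 = a * (u * g) ^ 2 := by ring
        _ = a' * (u' * g) ^ 2 := by rw [← hu, ← hu', h]
        _ = a' * u' ^ 2 * g ^ 2 := by ring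
    exact Nat.eq_of_mul_eq_mul_right (pow_pos hg0 2) h'
  have hu1 : u = 1 := by
    have hdvd : u ^ 2 ∣ a' * u' ^ 2 := ⟨a, by rw [← h2]; ring⟩
    have hdvd' : u ^ 2 ∣ a' := (Nat.Coprime.pow 2 2 hcop).dvd_of_dvd_mul_right hdvd
    exact Nat.isUnit_iff.1 (ha' u (by rwa [← sq]))
  have hu'1 : u' = 1 := by
    have hdvd : u' ^ 2 ∣ a * u ^ 2 := ⟨a', by rw [h2]; ring⟩
    have hdvd' : u' ^ 2 ∣ a := (Nat.Coprime.pow 2 2 hcop.symm).dvd_of_dvd_mul_right hdvd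
    exact Nat.isUnit_iff.1 (ha u' (by rwa [← sq]))
  rw [hu, hu', hu1, hu'1]

/-- Uniqueness of the decomposition `d = s · m²` (`s` squarefree, `m ≥ 1`) of a nonzero
integer: `s m² = s' m'²` with `s, s'` squarefree and `m ≥ 1` forces `s = s'` and `m = m'`.
[folklore] -/
theorem squarefree_mul_sq_unique {s s' : ℤ} {m m' : ℕ} (hs : Squarefree s) (hs' : Squarefree s')
    (hm : 0 < m) (h : s * (m : ℤ) ^ 2 = s' * (m' : ℤ) ^ 2) : s = s' ∧ m = m' := by
  have hnat : s.natAbs * m ^ 2 = s'.natAbs * m' ^ 2 := by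
    have := congrArg Int.natAbs h
    simpa [Int.natAbs_mul, Int.natAbs_pow] using this
  have hmm : m = m' :=
    sq_part_unique (Int.squarefree_natAbs.2 hs) (Int.squarefree_natAbs.2 hs') hm hnat
  subst hmm
  have hm0 : ((m : ℤ) ^ 2) ≠ 0 := pow_ne_zero 2 (by exact_mod_cast hm.ne')
  exact ⟨mul_right_cancel₀ hm0 h, rfl⟩

/-! ### Window counts as `Finset` cardinalities -/

/-
Throughout, the three window counts are written as cardinalities of filters of the window
`Finset.Icc (-X) X ⊆ ℤ`:
`A_P(X) = #{d squarefree, |d| ≤ X, P d} = ((Icc (-X) X).filter fun d ↦ Squarefree d ∧ P d).card`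
(the numerator of `twistDensity`), `A(X) = ((Icc (-X) X).filter fun d ↦ Squarefree d).card` (its
denominator), and `B_P(X) = #{d ≠ 0, |d| ≤ X, P d} = ((Icc (-X) X).filter fun d ↦ d ≠ 0 ∧ P d).card`
(the numerator of Smith's printed density). No auxiliary definition is introduced.
-/

/-- The numerator of `twistDensity` as a `Finset` cardinality. [folklore] -/
theorem natCard_setOf_squarefree_eq (P : ℤ → Prop) (X : ℕ) :
    Nat.card {d : ℤ | Squarefree d ∧ |d| ≤ (X : ℤ) ∧ P d} = ((Icc (-(X : ℤ)) X).filter fun d : ℤ ↦ Squarefree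
        d ∧ P d).card := by
  have hset : {d : ℤ | Squarefree d ∧ |d| ≤ (X : ℤ) ∧ P d} =
      ↑((Icc (-((X : ℕ) : ℤ)) X).filter fun d : ℤ ↦ Squarefree d ∧ P d) := by
    ext d
    simp only [Set.mem_setOf_eq, coe_filter, mem_Icc, abs_le]
    tauto
  rw [hset, Nat.card_coe_set_eq, Set.ncard_coe_finset]

/-- The denominator of `twistDensity` as a `Finset` cardinality. [folklore] -/
theorem natCard_setOf_squarefree_eq' (X : ℕ) :
    Nat.card {d : ℤ | Squarefree d ∧ |d| ≤ (X : ℤ)} = ((Icc (-(X : ℤ)) X).filter fun d : ℤ ↦ Squarefree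
        d).card := by
  have hset : {d : ℤ | Squarefree d ∧ |d| ≤ (X : ℤ)} =
      ↑((Icc (-((X : ℕ) : ℤ)) X).filter fun d : ℤ ↦ Squarefree d) := by
    ext d
    simp only [Set.mem_setOf_eq, coe_filter, mem_Icc, abs_le]
    tauto
  rw [hset, Nat.card_coe_set_eq, Set.ncard_coe_finset]

/-- The numerator of Smith's printed density as a `Finset` cardinality. [folklore] -/
theorem natCard_setOf_ne_zero_eq (P : ℤ → Prop) (X : ℕ) :
    Nat.card {d : ℤ | d ≠ 0 ∧ |d| ≤ (X : ℤ) ∧ P d} = ((Icc (-(X : ℤ)) X).filter fun d : ℤ ↦ d ≠ 0 ∧ P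
        d).card := by
  have hset : {d : ℤ | d ≠ 0 ∧ |d| ≤ (X : ℤ) ∧ P d} =
      ↑((Icc (-((X : ℕ) : ℤ)) X).filter fun d : ℤ ↦ d ≠ 0 ∧ P d) := by
    ext d
    simp only [Set.mem_setOf_eq, coe_filter, mem_Icc, abs_le]
    tauto
  rw [hset, Nat.card_coe_set_eq, Set.ncard_coe_finset]

/-- `A_P(0) = 0`: no squarefree `d` has `|d| ≤ 0`. [folklore] -/
theorem sqfreeCount_zero (P : ℤ → Prop) : ((Icc (-((0 : ℕ) : ℤ)) ((0 : ℕ) : ℤ)).filter fun d : ℤ ↦ Squarefree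
    d ∧ P d).card = 0 := by
  rw [Finset.card_eq_zero, Finset.filter_eq_empty_iff]
  intro d hd h
  simp only [CharP.cast_eq_zero, neg_zero, Icc_self, mem_singleton] at hd
  exact not_squarefree_zero (hd ▸ h.1)

/-- `A(0) = 0`: no squarefree `d` has `|d| ≤ 0`. [folklore] -/
theorem sqfreeCount_zero' : ((Icc (-((0 : ℕ) : ℤ)) ((0 : ℕ) : ℤ)).filter fun d : ℤ ↦ Squarefree
    d).card = 0 := by
  rw [Finset.card_eq_zero, Finset.filter_eq_empty_iff]
  intro d hd h
  simp only [CharP.cast_eq_zero, neg_zero, Icc_self, mem_singleton] at hd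
  exact not_squarefree_zero (hd ▸ h)

/-- `#{d ≠ 0, |d| ≤ X} = 2X`. [folklore] -/
theorem card_filter_ne_zero_Icc (X : ℕ) :
    ((Icc (-((X : ℕ) : ℤ)) X).filter fun d : ℤ ↦ d ≠ 0).card = 2 * X := by
  trans ((Icc (-(X : ℤ)) X).erase 0).card
  · congr 1
    ext d
    simp only [mem_filter, mem_erase, mem_Icc]
    tauto
  · rw [card_erase_of_mem (by simp), Int.card_Icc]
    omega

/-! ### The fibration of `{d ≠ 0, |d| ≤ X}` by the square part -/

/-- **Counting by square class.** If `P` is invariant under multiplication by nonzero squares,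
then `#{d ≠ 0, |d| ≤ X, P d} = ∑_{1 ≤ m ≤ X} #{s squarefree, |s| ≤ X/m², P s}`: the map
`(m, s) ↦ s m²` is a bijection onto `{d ≠ 0, |d| ≤ X}` (`exists_squarefree_mul_sq`,
`squarefree_mul_sq_unique`). [folklore] -/
theorem nonzeroCount_eq_sum_sqfreeCount {P : ℤ → Prop}
    (hP : ∀ (d : ℤ) (m : ℕ), m ≠ 0 → (P (d * (m : ℤ) ^ 2) ↔ P d)) (X : ℕ) :
    ((Icc (-(X : ℤ)) X).filter fun d : ℤ ↦ d ≠ 0 ∧ P d).card = ∑ m ∈ Icc 1 X, ((Icc (-((X / m ^ 2 : ℕ) : ℤ))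
        ((X / m ^ 2 : ℕ) : ℤ)).filter fun d : ℤ ↦ Squarefree d ∧ P d).card := by
  have hS : ∑ m ∈ Icc 1 X, ((Icc (-((X / m ^ 2 : ℕ) : ℤ)) ((X / m ^ 2 : ℕ) : ℤ)).filter fun d : ℤ ↦ Squarefree
      d ∧ P d).card =
      ((Icc 1 X).sigma fun m ↦ (Icc (-((X / m ^ 2 : ℕ) : ℤ)) ((X / m ^ 2 : ℕ) : ℤ)).filter
        fun d ↦ Squarefree d ∧ P d).card := by
    rw [card_sigma]
  rw [hS]
  symm
  refine card_bij (fun p _ ↦ p.2 * (p.1 : ℤ) ^ 2) (fun p hp ↦ ?_) (fun p hp q hq h ↦ ?_)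
    (fun d hd ↦ ?_)
  · -- maps into the window
    obtain ⟨m, s⟩ := p
    simp only [mem_sigma, mem_Icc, mem_filter] at hp
    obtain ⟨⟨hm1, -⟩, hs, hsq, hPs⟩ := hp
    have hm0 : m ≠ 0 := by omega
    simp only [mem_filter, mem_Icc]
    refine ⟨?_, mul_ne_zero hsq.ne_zero (pow_ne_zero 2 (by exact_mod_cast hm0)),
      (hP s m hm0).2 hPs⟩
    have habs : |s| ≤ ((X / m ^ 2 : ℕ) : ℤ) := abs_le.2 hs
    have hnat : s.natAbs ≤ X / m ^ 2 := by
      have : (s.natAbs : ℤ) ≤ ((X / m ^ 2 : ℕ) : ℤ) := by rwa [Int.natCast_natAbs]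
      exact_mod_cast this
    have hle : s.natAbs * m ^ 2 ≤ X := (Nat.le_div_iff_mul_le (by positivity)).1 hnat
    have habs' : |s * (m : ℤ) ^ 2| ≤ (X : ℤ) := by
      rw [abs_mul, abs_pow, Nat.abs_cast, Int.abs_eq_natAbs]
      exact_mod_cast hle
    exact abs_le.1 habs'
  · -- injective
    obtain ⟨m, s⟩ := p
    obtain ⟨m', s'⟩ := q
    simp only [mem_sigma, mem_Icc, mem_filter] at hp hq
    simp only at h
    obtain ⟨hss', hmm'⟩ := squarefree_mul_sq_unique hp.2.2.1 hq.2.2.1 (by omega) h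
    subst hss' hmm'
    rfl
  · -- surjective
    simp only [mem_filter, mem_Icc] at hd
    obtain ⟨⟨hdX, hdX'⟩, hd0, hPd⟩ := hd
    obtain ⟨s, m, hm, hs, rfl⟩ := exists_squarefree_mul_sq hd0
    have hm0 : m ≠ 0 := hm.ne'
    have hle : s.natAbs * m ^ 2 ≤ X := by
      have habs : |s * (m : ℤ) ^ 2| ≤ (X : ℤ) := abs_le.2 ⟨hdX, hdX'⟩
      rw [abs_mul, abs_pow, Nat.abs_cast, Int.abs_eq_natAbs] at habs
      exact_mod_cast habs
    refine ⟨⟨m, s⟩, ?_, rfl⟩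
    simp only [mem_sigma, mem_Icc, mem_filter]
    refine ⟨⟨hm, ?_⟩, ?_, hs, (hP s m hm0).1 hPd⟩
    · -- `m ≤ m² ≤ |s| m² ≤ X` (`|s| ≥ 1`)
      have hs1 : 1 ≤ s.natAbs := Int.natAbs_pos.2 hs.ne_zero
      nlinarith
    · have hnat : s.natAbs ≤ X / m ^ 2 := (Nat.le_div_iff_mul_le (by positivity)).2 hle
      have : |s| ≤ ((X / m ^ 2 : ℕ) : ℤ) := by
        rw [Int.abs_eq_natAbs]
        exact_mod_cast hnat
      exact abs_le.1 this

/-- The case `P = ⊤`: `∑_{1 ≤ m ≤ X} #{s squarefree, |s| ≤ X/m²} = 2X`. [folklore] -/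
theorem sum_sqfreeCount_true (X : ℕ) : ∑ m ∈ Icc 1 X, ((Icc (-((X / m ^ 2 : ℕ) : ℤ)) ((X / m ^ 2 : ℕ) :
    ℤ)).filter fun d : ℤ ↦ Squarefree d).card = 2 * X := by
  have h := nonzeroCount_eq_sum_sqfreeCount (P := fun _ ↦ True) (fun _ _ _ ↦ Iff.rfl) X
  simp only [and_true] at h
  rw [← h, card_filter_ne_zero_Icc]

/-! ### Möbius inversion over squares -/

/-- `∑_{d ∣ n} μ(d) = [n = 1]` in `ℝ` (Mathlib's `μ * ζ = 1`). [folklore] -/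
private theorem sum_divisors_moebius_real (n : ℕ) :
    ∑ d ∈ n.divisors, (μ d : ℝ) = if n = 1 then 1 else 0 := by
  have h := congrArg (fun f : ArithmeticFunction ℝ ↦ f n)
    (ArithmeticFunction.coe_moebius_mul_coe_zeta (R := ℝ))
  simpa only [ArithmeticFunction.coe_mul_zeta_apply, ArithmeticFunction.intCoe_apply,
    ArithmeticFunction.one_apply] using h

/-- Merging the two quotients: `⌊⌊X/k²⌋/m²⌋ = ⌊X/(km)²⌋`, and the inner range of
`F(⌊X/k²⌋) = ∑_{m ≤ X/k²} f(⌊X/(km)²⌋)` may be enlarged to `m ≤ X/k` (the added terms are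
`f 0 = 0`). [folklore] -/
theorem sum_Icc_div_sq_div_sq (f : ℕ → ℝ) (hf : f 0 = 0) (X : ℕ) {k : ℕ} (hk : 1 ≤ k) :
    ∑ m ∈ Icc 1 (X / k ^ 2), f (X / k ^ 2 / m ^ 2) = ∑ m ∈ Icc 1 (X / k), f (X / (k * m) ^ 2) := by
  have hk0 : 0 < k := hk
  have hsub : Icc 1 (X / k ^ 2) ⊆ Icc 1 (X / k) := by
    refine Icc_subset_Icc_right (Nat.div_le_div_left ?_ hk0)
    calc k = k ^ 1 := (pow_one k).symm
      _ ≤ k ^ 2 := Nat.pow_le_pow_right hk0 (by norm_num)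
  rw [← sum_subset hsub]
  · refine sum_congr rfl fun m _ ↦ ?_
    rw [Nat.div_div_eq_div_mul, mul_pow]
  · intro m hm hm'
    simp only [mem_Icc, not_and, not_le] at hm hm'
    have hlt : X / k ^ 2 < m := hm' hm.1
    have hX : X < (k * m) ^ 2 := by
      have h1 : X < m * k ^ 2 := (Nat.div_lt_iff_lt_mul (by positivity)).1 hlt
      calc X < m * k ^ 2 := h1
        _ ≤ m ^ 2 * k ^ 2 := by
          have : m ≤ m ^ 2 := by nlinarith [hm.1]
          exact Nat.mul_le_mul_right _ this
        _ = (k * m) ^ 2 := by ring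
    rw [Nat.div_eq_of_lt hX, hf]

/-- **Möbius inversion over squares.** For `f : ℕ → ℝ` with `f 0 = 0` put
`F(Y) = ∑_{1 ≤ m ≤ Y} f(⌊Y/m²⌋)`; then `f(X) = ∑_{1 ≤ k ≤ X} μ(k) F(⌊X/k²⌋)`: after merging the
quotients, the pairs `(k, m)` with `k m ≤ X` are the divisor pairs of the integers `n ≤ X`, and
`∑_{k ∣ n} μ(k) = [n = 1]`. [folklore] -/
theorem moebius_inversion_sq (f : ℕ → ℝ) (hf : f 0 = 0) (X : ℕ) :
    ∑ k ∈ Icc 1 X, (μ k : ℝ) * ∑ m ∈ Icc 1 (X / k ^ 2), f (X / k ^ 2 / m ^ 2) = f X := by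
  -- merge the quotients and enlarge the inner ranges to `m ≤ X / k`
  have h1 : ∑ k ∈ Icc 1 X, (μ k : ℝ) * ∑ m ∈ Icc 1 (X / k ^ 2), f (X / k ^ 2 / m ^ 2) =
      ∑ k ∈ Icc 1 X, ∑ m ∈ Icc 1 (X / k), (μ k : ℝ) * f (X / (k * m) ^ 2) := by
    refine sum_congr rfl fun k hk ↦ ?_
    rw [sum_Icc_div_sq_div_sq f hf X (mem_Icc.1 hk).1, mul_sum]
  rw [h1, sum_sigma']
  -- regroup the pairs `(k, m)`, `k m ≤ X`, by `n = k m`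
  have h2 : ∑ x ∈ (Icc 1 X).sigma (fun k ↦ Icc 1 (X / k)), (μ x.1 : ℝ) * f (X / (x.1 * x.2) ^ 2) =
      ∑ y ∈ (Icc 1 X).sigma (fun n ↦ n.divisorsAntidiagonal), (μ y.2.1 : ℝ) * f (X / y.1 ^ 2) := by
    refine sum_nbij' (fun x ↦ ⟨x.1 * x.2, (x.1, x.2)⟩) (fun y ↦ ⟨y.2.1, y.2.2⟩) ?_ ?_ ?_ ?_ ?_
    · rintro ⟨k, m⟩ hx
      simp only [mem_sigma, mem_Icc] at hx
      obtain ⟨⟨hk1, hkX⟩, hm1, hmX⟩ := hx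
      have hkm : k * m ≤ X := by
        have := (Nat.le_div_iff_mul_le hk1).1 hmX
        rwa [mul_comm] at this
      simp only [mem_sigma, mem_Icc, Nat.mem_divisorsAntidiagonal]
      exact ⟨⟨Nat.one_le_iff_ne_zero.2 (Nat.mul_ne_zero (by omega) (by omega)), hkm⟩, by simp,
        Nat.mul_ne_zero (by omega) (by omega)⟩
    · rintro ⟨n, ⟨k, m⟩⟩ hy
      simp only [mem_sigma, mem_Icc, Nat.mem_divisorsAntidiagonal] at hy
      obtain ⟨⟨hn1, hnX⟩, hkm, hn0⟩ := hy
      have hk0 : k ≠ 0 := fun h ↦ hn0 (by rw [← hkm, h, zero_mul])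
      have hm0 : m ≠ 0 := fun h ↦ hn0 (by rw [← hkm, h, mul_zero])
      simp only [mem_sigma, mem_Icc]
      refine ⟨⟨Nat.one_le_iff_ne_zero.2 hk0, ?_⟩, Nat.one_le_iff_ne_zero.2 hm0, ?_⟩
      · calc k ≤ k * m := Nat.le_mul_of_pos_right k (Nat.pos_of_ne_zero hm0)
          _ = n := hkm
          _ ≤ X := hnX
      · refine (Nat.le_div_iff_mul_le (Nat.pos_of_ne_zero hk0)).2 ?_
        rw [mul_comm, hkm]
        exact hnX
    · rintro ⟨k, m⟩ _
      rfl
    · rintro ⟨n, ⟨k, m⟩⟩ hy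
      simp only [mem_sigma, mem_Icc, Nat.mem_divisorsAntidiagonal] at hy
      obtain ⟨-, hkm, -⟩ := hy
      simp only [hkm]
    · rintro ⟨k, m⟩ _
      rfl
  rw [h2, sum_sigma]
  -- the inner sums are `[n = 1] · f(⌊X/n²⌋)`
  have h3 : ∀ n ∈ Icc 1 X, ∑ q ∈ n.divisorsAntidiagonal, (μ q.1 : ℝ) * f (X / n ^ 2) =
      if n = 1 then f X else 0 := by
    intro n _
    rw [← sum_mul, Nat.sum_divisorsAntidiagonal fun a _ ↦ (μ a : ℝ), sum_divisors_moebius_real]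
    split_ifs with h
    · rw [h, one_pow, Nat.div_one, one_mul]
    · rw [zero_mul]
  calc ∑ n ∈ Icc 1 X, ∑ q ∈ n.divisorsAntidiagonal, (μ q.1 : ℝ) * f (X / n ^ 2)
      = ∑ n ∈ Icc 1 X, if n = 1 then f X else 0 := sum_congr rfl h3
    _ = f X := by
      rw [sum_ite_eq']
      split_ifs with h
      · rfl
      · simp only [mem_Icc, le_refl, true_and, not_le, Nat.lt_one_iff] at h
        rw [h, hf]

/-! ### Elementary bounds on the window counts -/

/-- `#{d squarefree, |d| ≤ X, P d} ≤ #{d squarefree, |d| ≤ X}`. [folklore] -/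
theorem sqfreeCount_le (P : ℤ → Prop) (X : ℕ) : ((Icc (-(X : ℤ)) X).filter fun d : ℤ ↦ Squarefree d ∧ P
    d).card ≤ ((Icc (-(X : ℤ)) X).filter fun d : ℤ ↦ Squarefree d).card := by
  refine card_le_card fun d hd ↦ ?_
  simp only [mem_filter] at hd ⊢
  exact ⟨hd.1, hd.2.1⟩

/-- `#{d squarefree, |d| ≤ X} ≤ 2X + 1`. [folklore] -/
theorem sqfreeCount_true_le (X : ℕ) : ((Icc (-(X : ℤ)) X).filter fun d : ℤ ↦ Squarefree
    d).card ≤ 2 * X + 1 := by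
  have h : ((Icc (-(X : ℤ)) X).filter fun d : ℤ ↦ Squarefree d).card ≤ (Icc (-(X : ℤ)) X).card := by
    refine card_le_card fun d hd ↦ ?_
    simp only [mem_filter] at hd
    exact hd.1
  refine h.trans ?_
  rw [Int.card_Icc]
  omega

/-- `#{d ≠ 0, |d| ≤ X, P d} ≤ 2X`. [folklore] -/
theorem nonzeroCount_le (P : ℤ → Prop) (X : ℕ) : ((Icc (-(X : ℤ)) X).filter fun d : ℤ ↦ d ≠ 0 ∧ P
    d).card ≤ 2 * X := by
  rw [← card_filter_ne_zero_Icc X]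
  refine card_le_card fun d hd ↦ ?_
  simp only [mem_filter] at hd ⊢
  exact ⟨hd.1, hd.2.1⟩

/-- `#{1 ≤ n ≤ N : n not squarefree} ≤ (3/4) N`: such an `n` is divisible by `m²` for some
`2 ≤ m ≤ N`, there are `⌊N/m²⌋` multiples of `m²` in `[1, N]`, and
`∑_{m ≥ 2} 1/m² ≤ 1/4 + ∑_{m ≥ 3} 1/(m(m-1)) = 3/4`. [folklore] -/
theorem card_Ioc_filter_not_squarefree_le (N : ℕ) :
    (((Ioc 0 N).filter fun n ↦ ¬ Squarefree n).card : ℝ) ≤ 3 / 4 * N := by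
  have hsub : ((Ioc 0 N).filter fun n ↦ ¬ Squarefree n) ⊆
      (Icc 2 N).biUnion fun m ↦ (Ioc 0 N).filter fun n ↦ m ^ 2 ∣ n := by
    intro n hn
    rw [mem_filter, mem_Ioc] at hn
    obtain ⟨⟨hn0, hnN⟩, hns⟩ := hn
    rw [mem_biUnion]
    have hex : ∃ m : ℕ, m * m ∣ n ∧ ¬ IsUnit m := by
      by_contra hcon
      push Not at hcon
      exact hns fun m hm ↦ hcon m hm
    obtain ⟨m, hmn, hmu⟩ := hex
    rw [Nat.isUnit_iff] at hmu
    have hm0 : m ≠ 0 := by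
      rintro rfl
      rw [zero_mul, zero_dvd_iff] at hmn
      omega
    have hm2 : 2 ≤ m := by omega
    have hmleN : m ≤ N := (Nat.le_of_dvd hn0 ((dvd_mul_right m m).trans hmn)).trans hnN
    refine ⟨m, mem_Icc.2 ⟨hm2, hmleN⟩, ?_⟩
    rw [mem_filter, mem_Ioc]
    exact ⟨⟨hn0, hnN⟩, by rw [sq]; exact hmn⟩
  have hsum : ∑ m ∈ Icc 2 N, ((m : ℝ) ^ 2)⁻¹ ≤ 3 / 4 := by
    rcases lt_or_ge N 2 with hN | hN
    · rw [Finset.Icc_eq_empty (by omega), sum_empty]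
      norm_num
    · have hIcc : Icc 2 N = insert 2 (Ioc 2 N) := by
        ext m
        simp only [mem_Icc, mem_insert, mem_Ioc]
        omega
      rw [hIcc, sum_insert (by simp)]
      have h := sum_Ioc_inv_sq_le_sub (α := ℝ) (k := 2) (n := N) (by norm_num) hN
      have hN' : (0 : ℝ) ≤ (N : ℝ)⁻¹ := by positivity
      push_cast at h ⊢
      linarith
  calc (((Ioc 0 N).filter fun n ↦ ¬ Squarefree n).card : ℝ)
      ≤ (((Icc 2 N).biUnion fun m ↦ (Ioc 0 N).filter fun n ↦ m ^ 2 ∣ n).card : ℝ) := by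
        exact_mod_cast card_le_card hsub
    _ ≤ ∑ m ∈ Icc 2 N, ((((Ioc 0 N).filter fun n ↦ m ^ 2 ∣ n).card : ℕ) : ℝ) := by
        exact_mod_cast card_biUnion_le
    _ = ∑ m ∈ Icc 2 N, ((N / m ^ 2 : ℕ) : ℝ) := by
        refine sum_congr rfl fun m _ ↦ ?_
        rw [Nat.Ioc_filter_dvd_card_eq_div]
    _ ≤ ∑ m ∈ Icc 2 N, (N : ℝ) * ((m : ℝ) ^ 2)⁻¹ := by
        refine sum_le_sum fun m _ ↦ ?_
        have h : ((N / m ^ 2 : ℕ) : ℝ) ≤ (N : ℝ) / ((m ^ 2 : ℕ) : ℝ) := Nat.cast_div_le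
        rw [div_eq_mul_inv] at h
        push_cast at h
        exact h
    _ = (N : ℝ) * ∑ m ∈ Icc 2 N, ((m : ℝ) ^ 2)⁻¹ := by rw [mul_sum]
    _ ≤ (N : ℝ) * (3 / 4) := mul_le_mul_of_nonneg_left hsum (Nat.cast_nonneg _)
    _ = 3 / 4 * N := by ring

/-- **A positive proportion of the integers is squarefree**: `#{d squarefree, |d| ≤ X} ≥ X/4`
(even `#{1 ≤ n ≤ X : n squarefree} ≥ X/4`). [folklore] -/
theorem sqfreeCount_true_ge (X : ℕ) : (X : ℝ) / 4 ≤ ((Icc (-(X : ℤ)) X).filter fun d : ℤ ↦ Squarefree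
    d).card := by
  have h := card_filter_add_card_filter_not (s := Ioc 0 X) (p := Squarefree)
  rw [Nat.card_Ioc, Nat.sub_zero] at h
  have h' : (((Ioc 0 X).filter Squarefree).card : ℝ) +
      (((Ioc 0 X).filter fun n ↦ ¬ Squarefree n).card : ℝ) = X := by exact_mod_cast h
  have h2 := card_Ioc_filter_not_squarefree_le X
  have h3 : ((Ioc 0 X).filter Squarefree).card ≤ ((Icc (-(X : ℤ)) X).filter fun d : ℤ ↦ Squarefree
      d).card := by
    refine card_le_card_of_injOn (fun n ↦ (n : ℤ)) (fun n hn ↦ ?_)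
      (fun a _ b _ hab ↦ Nat.cast_injective (R := ℤ) hab)
    simp only [mem_coe, mem_filter, mem_Ioc] at hn
    simp only [mem_coe, mem_filter, mem_Icc]
    exact ⟨⟨by omega, by exact_mod_cast hn.1.2⟩, Int.squarefree_natCast.2 hn.2⟩
  have h3' : (((Ioc 0 X).filter Squarefree).card : ℝ) ≤ ((Icc (-(X : ℤ)) X).filter fun d : ℤ ↦ Squarefree
      d).card := by
    exact_mod_cast h3
  linarith

/-- `∑_{1 ≤ k ≤ X} 1/k² ≤ 2` (`1 + ∑_{k ≥ 2} 1/(k(k-1)) = 2`). [folklore] -/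
private theorem sum_Icc_inv_sq_le_two (X : ℕ) : ∑ k ∈ Icc 1 X, ((k : ℝ) ^ 2)⁻¹ ≤ 2 := by
  rcases Nat.eq_zero_or_pos X with rfl | hX
  · simp
  · have hIcc : Icc 1 X = insert 1 (Ioc 1 X) := by
      ext m
      simp only [mem_Icc, mem_insert, mem_Ioc]
      omega
    rw [hIcc, sum_insert (by simp)]
    have h := sum_Ioc_inv_sq_le_sub (α := ℝ) (k := 1) (n := X) one_ne_zero hX
    have hX' : (0 : ℝ) ≤ (X : ℝ)⁻¹ := by positivity
    push_cast at h ⊢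
    linarith

/-- The common tail estimate. If `|g(Y)| ≤ ε a(Y) + C · [Y ≥ 1]` for all `Y`, then
`∑_{1 ≤ m ≤ H} |g(⌊H/m²⌋)| ≤ ε ∑_{1 ≤ m ≤ H} a(⌊H/m²⌋) + C √H`, because `⌊H/m²⌋ ≥ 1` only for
`m ≤ √H`. [folklore] -/
theorem sum_abs_Icc_div_sq_le {g a : ℕ → ℝ} {ε C : ℝ} (hC : 0 ≤ C)
    (hg : ∀ Y, |g Y| ≤ ε * a Y + if Y = 0 then 0 else C) (H : ℕ) :
    ∑ m ∈ Icc 1 H, |g (H / m ^ 2)| ≤ ε * ∑ m ∈ Icc 1 H, a (H / m ^ 2) + C * Nat.sqrt H := by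
  have hind : ∑ m ∈ Icc 1 H, (if H / m ^ 2 = 0 then (0 : ℝ) else C) ≤ C * Nat.sqrt H := by
    rw [sum_ite, sum_const_zero, zero_add, sum_const, nsmul_eq_mul, mul_comm]
    refine mul_le_mul_of_nonneg_left ?_ hC
    have hsub : ((Icc 1 H).filter fun m ↦ ¬ H / m ^ 2 = 0) ⊆ Icc 1 (Nat.sqrt H) := by
      intro m hm
      simp only [mem_filter, mem_Icc, Nat.div_eq_zero_iff, not_or, not_lt] at hm ⊢
      exact ⟨hm.1.1, Nat.le_sqrt.2 (by rw [← sq]; exact hm.2.2)⟩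
    have := card_le_card hsub
    rw [Nat.card_Icc, Nat.add_sub_cancel] at this
    exact_mod_cast this
  calc ∑ m ∈ Icc 1 H, |g (H / m ^ 2)|
      ≤ ∑ m ∈ Icc 1 H, (ε * a (H / m ^ 2) + if H / m ^ 2 = 0 then 0 else C) :=
        sum_le_sum fun m _ ↦ hg _
    _ = ε * ∑ m ∈ Icc 1 H, a (H / m ^ 2) + ∑ m ∈ Icc 1 H, (if H / m ^ 2 = 0 then (0 : ℝ) else C) := by
        rw [sum_add_distrib, mul_sum]
    _ ≤ ε * ∑ m ∈ Icc 1 H, a (H / m ^ 2) + C * Nat.sqrt H := by linarith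

/-- The `√H` error term is negligible: for `H ≥ N²`, `C √H ≤ (C/N) · H`. [folklore] -/
theorem mul_natSqrt_le_of_sq_le {C η : ℝ} (hη : 0 < η) {N H : ℕ} (hN : C ≤ η * N)
    (hH : N ^ 2 ≤ H) : C * Nat.sqrt H ≤ η * H := by
  have hs : N ≤ Nat.sqrt H := Nat.le_sqrt.2 (by rw [← sq]; exact hH)
  have hs' : (N : ℝ) ≤ Nat.sqrt H := by exact_mod_cast hs
  have hss : ((Nat.sqrt H : ℕ) : ℝ) * Nat.sqrt H ≤ H := by exact_mod_cast Nat.sqrt_le H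
  have h0 : (0 : ℝ) ≤ Nat.sqrt H := Nat.cast_nonneg _
  calc C * Nat.sqrt H ≤ η * N * Nat.sqrt H := mul_le_mul_of_nonneg_right hN h0
    _ ≤ η * Nat.sqrt H * Nat.sqrt H := by gcongr
    _ = η * ((Nat.sqrt H : ℝ) * Nat.sqrt H) := by ring
    _ ≤ η * H := mul_le_mul_of_nonneg_left hss hη.le

/-! ### The two normalisations of the density agree for square-class invariant families -/

section Normalisation

variable {P : ℤ → Prop} {δ : ℝ}

/-- The defect identity: `B_P(H) − 2δH = ∑_{1 ≤ m ≤ H} (A_P(⌊H/m²⌋) − δ A(⌊H/m²⌋))`, where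
`A_P`, `A` count squarefree `d` (with `P`, resp. all) and `B_P` counts all `d ≠ 0` with `P`
(`nonzeroCount_eq_sum_sqfreeCount` for `P` and for `⊤`). [folklore] -/
theorem nonzeroCount_sub_eq_sum (hP : ∀ (d : ℤ) (m : ℕ), m ≠ 0 → (P (d * (m : ℤ) ^ 2) ↔ P d))
    (H : ℕ) :
    (((Icc (-(H : ℤ)) H).filter fun d : ℤ ↦ d ≠ 0 ∧ P d).card : ℝ) - δ * (2 * H) =
      ∑ m ∈ Icc 1 H, ((((Icc (-((H / m ^ 2 : ℕ) : ℤ)) ((H / m ^ 2 : ℕ) : ℤ)).filter fun d : ℤ ↦ Squarefree d ∧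
          P d).card : ℝ) - δ * ((Icc (-((H / m ^ 2 : ℕ) : ℤ)) ((H / m ^ 2 : ℕ) :
          ℤ)).filter fun d : ℤ ↦ Squarefree d).card) := by
  rw [sum_sub_distrib, ← mul_sum, nonzeroCount_eq_sum_sqfreeCount hP, Nat.cast_sum]
  congr 2
  have h' := congrArg (fun n : ℕ ↦ (n : ℝ)) (sum_sqfreeCount_true H)
  simp only [Nat.cast_sum, Nat.cast_mul, Nat.cast_ofNat] at h'
  exact h'.symm

/-- **From the squarefree normalisation to the printed one.** If `P` is invariant under nonzero
squares and `{d squarefree : P d}` has natural density `δ` among squarefree integers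
(`twistDensity P δ`), then `#{d ∈ ℤ ∖ {0} : |d| ≤ H, P d} / 2H → δ`. Proof: by the defect
identity, `|B_P(H) − 2δH| ≤ ∑_m |A_P(⌊H/m²⌋) − δ A(⌊H/m²⌋)| ≤ ε ∑_m A(⌊H/m²⌋) + C√H = 2εH + C√H`.
[folklore] -/
theorem tendsto_nonzeroCount_div_of_twistDensity
    (hP : ∀ (d : ℤ) (m : ℕ), m ≠ 0 → (P (d * (m : ℤ) ^ 2) ↔ P d)) (h : twistDensity P δ) :
    Tendsto (fun H : ℕ ↦ (((Icc (-(H : ℤ)) H).filter fun d : ℤ ↦ d ≠ 0 ∧ P d).card : ℝ) / (2 * H)) atTop (𝓝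
        δ) := by
  have h' : Tendsto (fun X : ℕ ↦ (((Icc (-(X : ℤ)) X).filter fun d : ℤ ↦ Squarefree d ∧ P d).card : ℝ) / ((Icc
      (-(X : ℤ)) X).filter fun d : ℤ ↦ Squarefree d).card)
      atTop (𝓝 δ) := by
    simpa only [twistDensity, natCard_setOf_squarefree_eq, natCard_setOf_squarefree_eq'] using h
  rw [Metric.tendsto_atTop] at h' ⊢
  intro ε hε
  obtain ⟨Y₀, hY₀⟩ := h' (ε / 3) (by positivity)
  -- pointwise control of the defect `D(Y) = A_P(Y) − δ A(Y)`
  set C : ℝ := (1 + |δ|) * (2 * Y₀ + 1) with hCdef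
  have hC : 0 ≤ C := by positivity
  have hD : ∀ Y : ℕ, |((((Icc (-(Y : ℤ)) Y).filter fun d : ℤ ↦ Squarefree d ∧ P d).card : ℝ) - δ * ((Icc (-(Y
      : ℤ)) Y).filter fun d : ℤ ↦ Squarefree d).card)| ≤
      ε / 3 * ((Icc (-(Y : ℤ)) Y).filter fun d : ℤ ↦ Squarefree d).card + if Y = 0 then 0 else C := by
    intro Y
    rcases Nat.eq_zero_or_pos Y with rfl | hYpos
    · rw [sqfreeCount_zero, sqfreeCount_zero']
      simp
    rw [if_neg hYpos.ne']
    have hA1pos : (0 : ℝ) < ((Icc (-(Y : ℤ)) Y).filter fun d : ℤ ↦ Squarefree d).card := by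
      have := sqfreeCount_true_ge Y
      have hY : (0 : ℝ) < Y := by exact_mod_cast hYpos
      linarith
    by_cases hY : Y₀ ≤ Y
    · have hd := hY₀ Y hY
      rw [Real.dist_eq] at hd
      have key : |(((Icc (-(Y : ℤ)) Y).filter fun d : ℤ ↦ Squarefree d ∧ P d).card : ℝ) - δ * ((Icc (-(Y : ℤ))
          Y).filter fun d : ℤ ↦ Squarefree d).card| =
          |(((Icc (-(Y : ℤ)) Y).filter fun d : ℤ ↦ Squarefree d ∧ P d).card : ℝ) / ((Icc (-(Y : ℤ)) Y).filter
              fun d : ℤ ↦ Squarefree d).card - δ| *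
            ((Icc (-(Y : ℤ)) Y).filter fun d : ℤ ↦ Squarefree d).card := by
        rw [← abs_of_pos hA1pos, ← abs_mul, abs_of_pos hA1pos, sub_mul,
          div_mul_cancel₀ _ hA1pos.ne']
      rw [key]
      have := mul_le_mul_of_nonneg_right hd.le hA1pos.le
      linarith
    · push Not at hY
      have hAP : (((Icc (-(Y : ℤ)) Y).filter fun d : ℤ ↦ Squarefree d ∧ P d).card : ℝ) ≤ ((Icc (-(Y : ℤ))
          Y).filter fun d : ℤ ↦ Squarefree d).card := by
        exact_mod_cast sqfreeCount_le P Y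
      have hA1 : (((Icc (-(Y : ℤ)) Y).filter fun d : ℤ ↦ Squarefree d).card : ℝ) ≤ 2 * Y + 1 := by
        exact_mod_cast sqfreeCount_true_le Y
      have hYle : (Y : ℝ) ≤ Y₀ := by exact_mod_cast hY.le
      have hAP0 : (0 : ℝ) ≤ ((Icc (-(Y : ℤ)) Y).filter fun d : ℤ ↦ Squarefree d ∧ P
          d).card := Nat.cast_nonneg _
      calc |(((Icc (-(Y : ℤ)) Y).filter fun d : ℤ ↦ Squarefree d ∧ P d).card : ℝ) - δ * ((Icc (-(Y : ℤ))
          Y).filter fun d : ℤ ↦ Squarefree d).card|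
          ≤ |(((Icc (-(Y : ℤ)) Y).filter fun d : ℤ ↦ Squarefree d ∧ P d).card : ℝ)| + |δ * ((Icc (-(Y : ℤ))
              Y).filter fun d : ℤ ↦ Squarefree d).card| := abs_sub _ _
        _ = ((Icc (-(Y : ℤ)) Y).filter fun d : ℤ ↦ Squarefree d ∧ P d).card + |δ| * ((Icc (-(Y : ℤ)) Y).filter
            fun d : ℤ ↦ Squarefree d).card := by
            rw [abs_of_nonneg hAP0, abs_mul, abs_of_pos hA1pos]
        _ ≤ (1 + |δ|) * ((Icc (-(Y : ℤ)) Y).filter fun d : ℤ ↦ Squarefree d).card := by nlinarith [abs_nonneg δ]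
        _ ≤ (1 + |δ|) * (2 * Y₀ + 1) := by
            refine mul_le_mul_of_nonneg_left ?_ (by positivity)
            linarith
        _ ≤ ε / 3 * ((Icc (-(Y : ℤ)) Y).filter fun d : ℤ ↦ Squarefree d).card + C :=
            le_add_of_nonneg_left (by positivity)
  -- choice of the threshold
  obtain ⟨N, hN⟩ := exists_nat_ge (3 * C / ε)
  refine ⟨max N 1 ^ 2, fun H hH ↦ ?_⟩
  have hN1 : 1 ≤ max N 1 := le_max_right _ _
  have hH1 : 1 ≤ H := le_trans (Nat.one_le_pow _ _ hN1) hH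
  have hHpos : (0 : ℝ) < H := by exact_mod_cast hH1
  have hCN : C ≤ ε / 3 * (max N 1 : ℕ) := by
    have h1 : (N : ℝ) ≤ (max N 1 : ℕ) := by exact_mod_cast le_max_left N 1
    rw [div_le_iff₀ hε] at hN
    nlinarith
  -- the estimate
  have hbound := sum_abs_Icc_div_sq_le hC hD H
  have h2H : ∑ m ∈ Icc 1 H, (((Icc (-((H / m ^ 2 : ℕ) : ℤ)) ((H / m ^ 2 : ℕ) : ℤ)).filter fun d : ℤ ↦
      Squarefree d).card : ℝ) = 2 * H := by
    have := sum_sqfreeCount_true H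
    exact_mod_cast this
  rw [h2H] at hbound
  have hsqrt := mul_natSqrt_le_of_sq_le (by positivity : 0 < ε / 3) hCN hH
  have habs : |(((Icc (-(H : ℤ)) H).filter fun d : ℤ ↦ d ≠ 0 ∧ P d).card : ℝ) - δ * (2 * H)| ≤ ε / 3 * (2 *
      H) + ε / 3 * H := by
    rw [nonzeroCount_sub_eq_sum hP]
    refine (abs_sum_le_sum_abs _ _).trans ?_
    linarith
  rw [Real.dist_eq, show (((Icc (-(H : ℤ)) H).filter fun d : ℤ ↦ d ≠ 0 ∧ P d).card : ℝ) / (2 * H) - δ =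
      ((((Icc (-(H : ℤ)) H).filter fun d : ℤ ↦ d ≠ 0 ∧ P d).card : ℝ) - δ * (2 * H)) / (2 * H) by field_simp, abs_div,
    abs_of_pos (by positivity : (0 : ℝ) < 2 * H), div_lt_iff₀ (by positivity)]
  have hεH : 0 < ε * H := mul_pos hε hHpos
  linarith

/-- **From the printed normalisation to the squarefree one.** If `P` is invariant under nonzero
squares and `#{d ∈ ℤ ∖ {0} : |d| ≤ H, P d} / 2H → δ`, then `twistDensity P δ`. Proof: by
Möbius inversion over squares the defect `D(X) = A_P(X) − δA(X)` is
`∑_{k ≤ X} μ(k) E(⌊X/k²⌋)` with `E(Y) = B_P(Y) − 2δY = o(Y)`, so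
`|D(X)| ≤ 2ε X ∑_k k⁻² + C√X ≤ 4εX + C√X`; and `A(X) ≥ X/4`. [folklore] -/
theorem twistDensity_of_tendsto_nonzeroCount_div
    (hP : ∀ (d : ℤ) (m : ℕ), m ≠ 0 → (P (d * (m : ℤ) ^ 2) ↔ P d))
    (h : Tendsto (fun H : ℕ ↦ (((Icc (-(H : ℤ)) H).filter fun d : ℤ ↦ d ≠ 0 ∧ P d).card : ℝ) / (2 * H)) atTop
        (𝓝 δ)) :
    twistDensity P δ := by
  have goal : Tendsto (fun X : ℕ ↦ (((Icc (-(X : ℤ)) X).filter fun d : ℤ ↦ Squarefree d ∧ P d).card : ℝ) /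
      ((Icc (-(X : ℤ)) X).filter fun d : ℤ ↦ Squarefree d).card)
      atTop (𝓝 δ) := by
    rw [Metric.tendsto_atTop] at h ⊢
    intro ε hε
    obtain ⟨Y₀, hY₀⟩ := h (ε / 24) (by positivity)
    -- pointwise control of `E(Y) = B_P(Y) − 2δY`
    set C : ℝ := (1 + |δ|) * (2 * Y₀) with hCdef
    have hC : 0 ≤ C := by positivity
    have hE : ∀ Y : ℕ, |(|(((Icc (-(Y : ℤ)) Y).filter fun d : ℤ ↦ d ≠ 0 ∧ P d).card : ℝ) - δ * (2 * Y)|)| ≤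
        ε / 24 * (2 * Y) + if Y = 0 then 0 else C := by
      intro Y
      rw [abs_abs]
      rcases Nat.eq_zero_or_pos Y with rfl | hYpos
      · have h0 : ((Icc (-((0 : ℕ) : ℤ)) ((0 : ℕ) : ℤ)).filter fun d : ℤ ↦ d ≠ 0 ∧ P
          d).card = 0 := Nat.le_zero.1 (nonzeroCount_le P 0)
        rw [h0]
        simp
      rw [if_neg hYpos.ne']
      have hY2 : (0 : ℝ) < 2 * Y := by positivity
      by_cases hY : Y₀ ≤ Y
      · have hd := hY₀ Y hY
        rw [Real.dist_eq] at hd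
        have key : |(((Icc (-(Y : ℤ)) Y).filter fun d : ℤ ↦ d ≠ 0 ∧ P d).card : ℝ) - δ * (2 * Y)| =
            |(((Icc (-(Y : ℤ)) Y).filter fun d : ℤ ↦ d ≠ 0 ∧ P d).card : ℝ) / (2 * Y) - δ| * (2 * Y) := by
          rw [← abs_of_pos hY2, ← abs_mul, abs_of_pos hY2, sub_mul, div_mul_cancel₀ _ hY2.ne']
        rw [key]
        have := mul_le_mul_of_nonneg_right hd.le hY2.le
        linarith
      · push Not at hY
        have hB : (((Icc (-(Y : ℤ)) Y).filter fun d : ℤ ↦ d ≠ 0 ∧ P d).card : ℝ) ≤ 2 * Y := by exact_mod_cast nonzeroCount_le P Y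
        have hB0 : (0 : ℝ) ≤ ((Icc (-(Y : ℤ)) Y).filter fun d : ℤ ↦ d ≠ 0 ∧ P d).card := Nat.cast_nonneg _
        have hYle : (Y : ℝ) ≤ Y₀ := by exact_mod_cast hY.le
        calc |(((Icc (-(Y : ℤ)) Y).filter fun d : ℤ ↦ d ≠ 0 ∧ P d).card : ℝ) - δ * (2 * Y)|
            ≤ |(((Icc (-(Y : ℤ)) Y).filter fun d : ℤ ↦ d ≠ 0 ∧ P d).card : ℝ)| + |δ * (2 * Y)| := abs_sub _ _
          _ = ((Icc (-(Y : ℤ)) Y).filter fun d : ℤ ↦ d ≠ 0 ∧ P d).card + |δ| * (2 * Y) := by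
              rw [abs_of_nonneg hB0, abs_mul, abs_of_pos hY2]
          _ ≤ (1 + |δ|) * (2 * Y) := by nlinarith [abs_nonneg δ]
          _ ≤ C := by
              rw [hCdef]
              exact mul_le_mul_of_nonneg_left (by linarith) (by positivity)
          _ ≤ ε / 24 * (2 * Y) + C := le_add_of_nonneg_left (by positivity)
    -- Möbius inversion for the defect `D`
    set D : ℕ → ℝ := fun Y ↦ (((Icc (-(Y : ℤ)) Y).filter fun d : ℤ ↦ Squarefree d ∧ P d).card : ℝ) - δ * ((Icc
        (-(Y : ℤ)) Y).filter fun d : ℤ ↦ Squarefree d).card with hDdef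
    have hD0 : D 0 = 0 := by
      simp only [hDdef]
      rw [sqfreeCount_zero, sqfreeCount_zero']
      simp
    have hDX : ∀ X : ℕ, D X = ∑ k ∈ Icc 1 X, (μ k : ℝ) *
        ((((Icc (-((X / k ^ 2 : ℕ) : ℤ)) ((X / k ^ 2 : ℕ) : ℤ)).filter fun d : ℤ ↦ d ≠ 0 ∧ P d).card : ℝ) - δ
            * (2 * (X / k ^ 2 : ℕ))) := by
      intro X
      rw [← moebius_inversion_sq D hD0 X]
      refine sum_congr rfl fun k _ ↦ ?_
      rw [nonzeroCount_sub_eq_sum hP]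
    -- threshold
    obtain ⟨N, hN⟩ := exists_nat_ge (24 * C / ε)
    refine ⟨max N 1 ^ 2, fun X hX ↦ ?_⟩
    have hN1 : 1 ≤ max N 1 := le_max_right _ _
    have hX1 : 1 ≤ X := le_trans (Nat.one_le_pow _ _ hN1) hX
    have hXpos : (0 : ℝ) < X := by exact_mod_cast hX1
    have hCN : C ≤ ε / 24 * (max N 1 : ℕ) := by
      have h1 : (N : ℝ) ≤ (max N 1 : ℕ) := by exact_mod_cast le_max_left N 1
      rw [div_le_iff₀ hε] at hN
      nlinarith
    -- `|D X| ≤ ∑_k |E(⌊X/k²⌋)| ≤ (ε/24)·∑_k 2⌊X/k²⌋ + C√X ≤ (ε/24)(4X) + (ε/24) X`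
    have hbound := sum_abs_Icc_div_sq_le (g := fun Y ↦ |(((Icc (-(Y : ℤ)) Y).filter fun d : ℤ ↦ d ≠ 0 ∧ P
        d).card : ℝ) - δ * (2 * Y)|)
      (a := fun Y ↦ (2 * Y : ℝ)) hC hE X
    have hsumk : ∑ k ∈ Icc 1 X, (2 * ((X / k ^ 2 : ℕ) : ℝ)) ≤ 4 * X := by
      have h1 : ∀ k ∈ Icc 1 X, (2 * ((X / k ^ 2 : ℕ) : ℝ)) ≤ 2 * X * ((k : ℝ) ^ 2)⁻¹ := by
        intro k _
        have h : ((X / k ^ 2 : ℕ) : ℝ) ≤ (X : ℝ) / ((k ^ 2 : ℕ) : ℝ) := Nat.cast_div_le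
        rw [div_eq_mul_inv] at h
        push_cast at h
        linarith
      refine (sum_le_sum h1).trans ?_
      rw [← mul_sum]
      have := sum_Icc_inv_sq_le_two X
      nlinarith
    have hsqrt := mul_natSqrt_le_of_sq_le (by positivity : 0 < ε / 24) hCN hX
    have habsD : |D X| ≤ ε / 24 * (4 * X) + ε / 24 * X := by
      rw [hDX X]
      refine (abs_sum_le_sum_abs _ _).trans ?_
      have hμ : ∀ k ∈ Icc 1 X, |(μ k : ℝ) * ((((Icc (-((X / k ^ 2 : ℕ) : ℤ)) ((X / k ^ 2 : ℕ) : ℤ)).filter fun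
          d : ℤ ↦ d ≠ 0 ∧ P d).card : ℝ) -
          δ * (2 * (X / k ^ 2 : ℕ)))| ≤
          |(|(((Icc (-((X / k ^ 2 : ℕ) : ℤ)) ((X / k ^ 2 : ℕ) : ℤ)).filter fun d : ℤ ↦ d ≠ 0 ∧ P d).card : ℝ)
              - δ * (2 * ((X / k ^ 2 : ℕ) : ℕ))|)| := by
        intro k _
        rw [abs_abs, abs_mul]
        have h1 : |(μ k : ℝ)| ≤ 1 := by
          have := ArithmeticFunction.abs_moebius_le_one (n := k)
          exact_mod_cast this
        exact mul_le_of_le_one_left (abs_nonneg _) h1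
      refine (sum_le_sum hμ).trans ?_
      refine hbound.trans ?_
      have : ε / 24 * ∑ k ∈ Icc 1 X, (2 * ((X / k ^ 2 : ℕ) : ℝ)) ≤ ε / 24 * (4 * X) :=
        mul_le_mul_of_nonneg_left hsumk (by positivity)
      linarith
    -- conclusion: divide by `A(X) ≥ X/4`
    have hA := sqfreeCount_true_ge X
    have hApos : (0 : ℝ) < ((Icc (-(X : ℤ)) X).filter fun d : ℤ ↦ Squarefree d).card := by linarith
    rw [Real.dist_eq, show (((Icc (-(X : ℤ)) X).filter fun d : ℤ ↦ Squarefree d ∧ P d).card : ℝ) / ((Icc (-(X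
        : ℤ)) X).filter fun d : ℤ ↦ Squarefree d).card - δ =
        D X / ((Icc (-(X : ℤ)) X).filter fun d : ℤ ↦ Squarefree d).card by rw [hDdef]; field_simp, abs_div,
      abs_of_pos hApos, div_lt_iff₀ hApos]
    have hεX : 0 < ε * X := mul_pos hε hXpos
    have hεA : ε * ((X : ℝ) / 4) ≤ ε * ((Icc (-(X : ℤ)) X).filter fun d : ℤ ↦ Squarefree d).card :=
      mul_le_mul_of_nonneg_left hA hε.le
    calc |D X| ≤ ε / 24 * (4 * X) + ε / 24 * X := habsD
      _ < ε * ((X : ℝ) / 4) := by linarith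
      _ ≤ ε * ((Icc (-(X : ℤ)) X).filter fun d : ℤ ↦ Squarefree d).card := hεA
  simpa only [twistDensity, natCard_setOf_squarefree_eq, natCard_setOf_squarefree_eq'] using goal

/-- **The two normalisations agree.** For a family `P` of integers invariant under
multiplication by nonzero squares, the natural density of `{d squarefree : P d}` among
squarefree integers ordered by `|d|` (`twistDensity P δ`, the tree's convention) exists and
equals `δ` if and only if `lim_{H → ∞} #{d ∈ ℤ, d ≠ 0, |d| ≤ H, P d} / 2H = δ` (the convention of
Smith, arXiv:2503.17619, Thm. 1.1, where `d` ranges over all nonzero integers). [folklore] -/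
theorem twistDensity_iff_tendsto_of_sq_invariant
    (hP : ∀ (d : ℤ) (m : ℕ), m ≠ 0 → (P (d * (m : ℤ) ^ 2) ↔ P d)) :
    twistDensity P δ ↔
      Tendsto (fun H : ℕ ↦ (Nat.card {d : ℤ | d ≠ 0 ∧ |d| ≤ (H : ℤ) ∧ P d} : ℝ) / (2 * H))
        atTop (𝓝 δ) := by
  simp only [natCard_setOf_ne_zero_eq]
  exact ⟨tendsto_nonzeroCount_div_of_twistDensity hP, twistDensity_of_tendsto_nonzeroCount_div hP⟩

end Normalisation

/-! ### Smith's Theorem 1.1 in its printed normalisation -/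

section Smith

variable (W : WeierstrassCurve ℚ)

/-- **The `2^∞`-Selmer corank of `E^d` depends only on the square class of `d`.** Twisting by
`d e²` (`e ≠ 0`) gives a curve `ℚ`-isomorphic to the twist by `d`
(`WeierstrassCurve.exists_variableChange_quadraticTwist_mul_sq`; Silverman, *AEC*, X.2
Prop. 2.4, X.5 Cor. 5.4), and isomorphic curves have isomorphic `p^∞`-Selmer groups
(`selmerCorank_eq_of_variableChange`; Silverman, *AEC*, X.§4). [cite: SilvermanAEC2009, X.§4] -/
theorem selmerCorankTwoInfty_quadraticTwist_mul_sq (d e : ℚ) (he : e ≠ 0) :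
    selmerCorankTwoInfty (W.quadraticTwist (d * e ^ 2)) =
      selmerCorankTwoInfty (W.quadraticTwist d) := by
  obtain ⟨C, hC⟩ := W.exists_variableChange_quadraticTwist_mul_sq d e he
  rw [selmerCorankTwoInfty_eq, selmerCorankTwoInfty_eq]
  exact (selmerCorank_eq_of_variableChange 2 hC).symm

/-- The predicate "`d ≠ 0` and `r_{2^∞}(E^d) = r`" of Smith's Theorem 1.1 is invariant under
multiplication of `d` by nonzero squares. [folklore] -/
theorem ne_zero_and_selmerCorankTwoInfty_eq_sq_invariant (r : ℕ) (d : ℤ) (m : ℕ) (hm : m ≠ 0) :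
    (d * (m : ℤ) ^ 2 ≠ 0 ∧
        selmerCorankTwoInfty (W.quadraticTwist ((d * (m : ℤ) ^ 2 : ℤ) : ℚ)) = r) ↔
      (d ≠ 0 ∧ selmerCorankTwoInfty (W.quadraticTwist (d : ℚ)) = r) := by
  have hm' : (m : ℚ) ≠ 0 := by exact_mod_cast hm
  have hm'' : ((m : ℤ) ^ 2 : ℤ) ≠ 0 := pow_ne_zero 2 (by exact_mod_cast hm)
  push_cast
  rw [selmerCorankTwoInfty_quadraticTwist_mul_sq W _ _ hm']
  exact and_congr (mul_ne_zero_iff.trans ⟨fun h ↦ h.1, fun h ↦ ⟨h, hm''⟩⟩) Iff.rfl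

/-- **bsd.S34 — Smith's Theorem 1.1 as printed** (A. Smith, *The Birch and Swinnerton-Dyer
conjecture implies Goldfeld's conjecture*, arXiv:2503.17619 (2025), **Thm. 1.1**): "for any
elliptic curve `E` over `ℚ` and any nonnegative integer `r`,
`lim_{H → ∞} #{d ∈ ℤ^{≠0} : |d| ≤ H and r_{2^∞}(E^d) = r} / 2H = 1/2` for `r = 0`, `1/2` if
`r = 1`, `0` if `r ≥ 2`." The tree's transcription `smith_selmerCorank_density W` (`BSDSelmer`)
uses instead the natural density among *squarefree* `d` ordered by `|d|` (`twistDensity`). The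
two statements are EQUIVALENT, curve by curve: the corank predicate depends only on the square
class of `d` (`selmerCorankTwoInfty_quadraticTwist_mul_sq`), and for square-class invariant
families the two normalisations of the density agree
(`twistDensity_iff_tendsto_of_sq_invariant`: fibre `ℤ ∖ {0}` over the squarefree integers by
`d = s m²`, Möbius inversion over squares, and the positive density of squarefree integers).
This settles the faithfulness of the vendored normalisation; it does not prove Thm. 1.1.
[cite: arXiv250317619, Thm. 1.1] -/
theorem smith_selmerCorank_density_iff_printed :
    smith_selmerCorank_density W ↔
      (Tendsto (fun H : ℕ ↦ (Nat.card {d : ℤ | d ≠ 0 ∧ |d| ≤ (H : ℤ) ∧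
          selmerCorankTwoInfty (W.quadraticTwist d) = 0} : ℝ) / (2 * H)) atTop (𝓝 (1 / 2)) ∧
        Tendsto (fun H : ℕ ↦ (Nat.card {d : ℤ | d ≠ 0 ∧ |d| ≤ (H : ℤ) ∧
          selmerCorankTwoInfty (W.quadraticTwist d) = 1} : ℝ) / (2 * H)) atTop (𝓝 (1 / 2)) ∧
        ∀ r : ℕ, 2 ≤ r → Tendsto (fun H : ℕ ↦ (Nat.card {d : ℤ | d ≠ 0 ∧ |d| ≤ (H : ℤ) ∧
          selmerCorankTwoInfty (W.quadraticTwist d) = r} : ℝ) / (2 * H)) atTop (𝓝 0)) := by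
  have key : ∀ (r : ℕ) (δ : ℝ),
      twistDensity (fun d ↦ d ≠ 0 ∧ selmerCorankTwoInfty (W.quadraticTwist d) = r) δ ↔
        Tendsto (fun H : ℕ ↦ (Nat.card {d : ℤ | d ≠ 0 ∧ |d| ≤ (H : ℤ) ∧
          selmerCorankTwoInfty (W.quadraticTwist d) = r} : ℝ) / (2 * H)) atTop (𝓝 δ) := by
    intro r δ
    rw [twistDensity_iff_tendsto_of_sq_invariant
      (ne_zero_and_selmerCorankTwoInfty_eq_sq_invariant W r)]
    have hset : ∀ H : ℕ, {d : ℤ | d ≠ 0 ∧ |d| ≤ (H : ℤ) ∧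
        (d ≠ 0 ∧ selmerCorankTwoInfty (W.quadraticTwist d) = r)} =
        {d : ℤ | d ≠ 0 ∧ |d| ≤ (H : ℤ) ∧ selmerCorankTwoInfty (W.quadraticTwist d) = r} := by
      intro H
      ext d
      simp only [Set.mem_setOf_eq]
      tauto
    simp only [hset]
  unfold smith_selmerCorank_density
  rw [key 0, key 1]
  exact and_congr Iff.rfl (and_congr Iff.rfl
    (forall_congr' fun r ↦ imp_congr_right fun _ ↦ key r 0))

/-- **Smith's Theorem 1.1, printed form, from the vendored fact** (the direction a consumer of
arXiv:2503.17619 verbatim needs). [cite: arXiv250317619, Thm. 1.1] -/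
theorem smith_selmerCorank_density.printed (h : smith_selmerCorank_density W) (r : ℕ) :
    Tendsto (fun H : ℕ ↦ (Nat.card {d : ℤ | d ≠ 0 ∧ |d| ≤ (H : ℤ) ∧
        selmerCorankTwoInfty (W.quadraticTwist d) = r} : ℝ) / (2 * H)) atTop
      (𝓝 (if r ≤ 1 then 1 / 2 else 0)) := by
  obtain ⟨h0, h1, h2⟩ := (smith_selmerCorank_density_iff_printed W).1 h
  rcases Nat.lt_or_ge r 2 with hr | hr
  · rw [if_pos (by omega)]
    interval_cases r
    · exact h0
    · exact h1
  · rw [if_neg (by omega)]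
    exact h2 r hr

end Smith

end Literature.NumberTheory.EllipticCurves

end
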